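import Summits.BirchSwinnertonDyer.BirchSwinnertonDyer.Theorems.ErratumRoadFiveAuxNormReceptacle
import Summits.BirchSwinnertonDyer.BirchSwinnertonDyer.Theorems.ErratumRoadFiveAuxNormRelativeStabilizerLaw
import Summits.BirchSwinnertonDyer.BirchSwinnertonDyer.Theorems.ErratumRoadFiveAuxPrimeSupply
import Summits.BirchSwinnertonDyer.BirchSwinnertonDyer.Theorems.ClassRecordThreeEulerHalvesAtThreeCarrierLocalE0AtThree
import Summits.BirchSwinnertonDyer.BirchSwinnertonDyer.Theorems.ClassRecordThreeEulerHalvesAtThreeShimuraAuxNormE0Prime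
import HarnessLib

/-!
# ROAD B of crux 19715's auxiliary-norm lever, in `Theorems/`: the carrier E′-label binder `hE0T` with ZERO leaf stubs
# (route `ErratumRoadFive`, crux `EulerHalfNotRamNoInertSetAtFive` = item stmt-BirchSwinnertonDyer-19715, cell `bsd-stepL`;
# width seat `bsd-line-er5-p1-w6` g0; `--supports stmt-BirchSwinnertonDyer-19715`)

WHAT. The importable, sorry-free `Theorems/` PORT of §5 of the crux workfile `Cruxes/EulerHalfNotRamNoInertSetAtFive/Lines/aux_norm_receptacle.lean` v6
(bsd-idea-9 g10, commit ac28884a9e55, sha16 47421ad85fb45e0f). Along line `birth` v15 the crux is closed modulo seven route items and the binder `hE0T`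
«at every K-split multiplicative carrier `q ∉ S` with `p ∣ c_q`, a prime-to-`p` multiple of the CM family `ys m` lies in `E₀(K[m])_w` at every `w ∋ q`»
(Gross's E′-label), which road A produces from the leaves S1-lin, S2♭, (C), (O) (`AuxNormReceptacle.carrierLabelsE0Prime_of_leaves` ∕ `…_of_linearLeaves`).
ROAD B gives the SAME conclusion from TREE THEOREMS ONLY:
* §1 `CarrierLocalE0OddPrime` = bsd-stepL-tam3-p1 g18's `CarrierLocalE0.*` (p643818 ∕ p644399) ported from `3 ∣ c_q` to an ODD prime `p ∣ c_q`: over the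
  completion `L_w` of a place `w ∣ q` unramified over `ℚ`, `c_w = c_q` (tree: `split_or_typeIV_of_odd_prime_dvd_localTamagawaNumber`), hence (C_w)
  `c_q • Q ∈ E₀(L_w)`, (T_w) `E(L_w) = ι E(ℚ_q) + E₀(L_w)`, their global forms (C), (T) at `w`, and both on the ring class tower `K[n]`, `q ∤ n`, `q` split
  in `K` (unramified by the tree theorem `CarrierLocalE0.not_map_le_sq_ringClassField`, p645044).
* §2 `AuxNormReceptacle.carrierLabelsE0Prime_of_galTrivialRoad` = tam3-p1 g18's `ShimuraWalk.carrierLabelsE0Prime_of_galTrivial_of_kills_of_auxLevel` (p641143)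
  fed with §1 and `AuxNormReceptacle.auxiliaryInertLevel_of_laws` (LEAD er5-p1 g3, p644422) on S2♭ `AuxNormReceptacle.relativeStabilizerLaw`
  (bsd-line-er5-p1-w4 g8, p642411) and S3♭ `AuxPrimeSupply.auxiliaryPrimeSupply` (bsd-line-er5-p1-w2 g5, p645521); plus the one-exponent plug.
  Drop-in for the LEAD's closer `EulerHalfAuxNorm.shimuraInertSavedDisplayAtD_of_primitivesFromFive_of_linearLeaves` §1:
  `have hE0T := AuxNormReceptacle.carrierLabelsE0Prime_of_galTrivialRoad W ι hK hD hp5 hsurj (NeZero.ne N) (S := S) hsp ys hL` (hS1 ∕ hS2 ∕ hC ∕ hO unused there).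

HONEST FRAMING. Theorems only (no `def`, no named fact, no `sorry`, no instance ∕ notation); proofs = v6 §5 VERBATIM up to the namespaces, v6's restated
`not_map_le_sq_ringClassField_of_split` ↦ the tree theorem it copied, v6's local glue ∕ S2♭ ∕ S3♭ wrappers ↦ the tree theorems they wrap. Nothing here
closes 19715 (its `_of` keeps the seven route items {19066, 19064, 19524, 19716, 20191, 20442, 27981}); no summit statement is proved; BSD is proved for
no curve (T7). presearch: n/a (port; nearest print Gross *LMS* 153 p. 245 «replace `E⁰` by `E′`»). Axioms: `propext`, `Classical.choice`, `Quot.sound`.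
[cite: GrossLMS1991, §3 Prop. 3.7 (1), §6 proof of Prop. 6.2 (1) (p. 245)] [cite: SilvermanATAEC1994, IV Cor. 9.2 (d), IV.9.4 Table 4.1]
[cite: SilvermanAEC2009, VII Prop. 2.1, Prop. VII.5.4 (a), Thm. VII.6.1] [cite: Cox2013, Thm. 7.24, Thm. 8.12, §9.A]
[cite: CasselsFrohlichANT1967, Ch. VII §1.1] [cite: Serre1972, §4.4 Lemme 3]
-/

set_option autoImplicit false
set_option linter.dupNamespace false

noncomputable section
open scoped Classical NumberField Pointwise
/-! ## §1 (T) + (C) at an ODD prime `p ∣ c_q` over an unramified place, and on the ring class tower at a K-split carrier -/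
namespace Summit.BirchSwinnertonDyer.BirchSwinnertonDyer.Theorems.CarrierLocalE0OddPrime

open WeierstrassCurve IsDedekindDomain NumberField Field Literature.NumberTheory.EllipticCurves
  Literature.NumberTheory.EllipticCurves.RingClassField
  Literature.NumberTheory.DiophantineGeometry Literature.NumberTheory.Automorphic IsLocalRing
  Literature.NumberTheory.GaloisRepresentations Summit.BirchSwinnertonDyer.Rank1Residual.X11b.Three
  Summit.BirchSwinnertonDyer.BirchSwinnertonDyer.Theorems
  Summit.BirchSwinnertonDyer.BirchSwinnertonDyer.Theorems.CarrierLocalE0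

variable (W : WeierstrassCurve ℚ) [W.IsElliptic] [W.IsGloballyMinimal]
  {L : Type} [Field L] [NumberField L] (w : HeightOneSpectrum (𝓞 L))

/-! ### §1a Over the completion `L_w` of an unramified place `w ∣ q`: `c_w = c_q`, (C_w), (T_w) for an ODD prime `p ∣ c_q`
(port of `Theorems.CarrierLocalE0.*_of_three_dvd` etc., bsd-stepL-tam3-p1 g18 p643818, with `3 ∣ c_q` replaced by `p ∣ c_q`, `p` an odd prime) -/

/-- **`c_w(W_L) = c_q(W)` at a place `w ∣ q` UNRAMIFIED over `ℚ` when an ODD prime `p` divides `c_q(W/ℚ_q)`** (`W/ℚ` globally minimal).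
Split case (`I_n`, `p ∣ n = c_q`, `n ≥ 3`): `c_q ∣ c_w ≤ max 4 (ord_w Δ_min) = max 4 c_q`; else `p = 3`, Kodaira IV ∕ IV*, `c_q = 3`, additivity
transports, `c_w ≤ 4`, `3 ∣ c_w`. (FALSE for `p = 2` or without `p ∣ c_q`.) Port of tam3-p1 g18's `…_of_three_dvd` to a general odd prime.
[cite: SilvermanATAEC1994, IV Cor. 9.2 (d), IV.9.4 Table 4.1] [cite: SilvermanAEC2009, Prop. VII.5.4 (a), Thm. VII.6.1] -/
theorem localTamagawaNumber_completion_eq_padic_of_unramified_of_odd_prime_dvd (q : ℕ) [Fact q.Prime]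
    (hqw : ((q : ℕ) : 𝓞 L) ∈ w.asIdeal) (he : ¬ (w.under (𝓞 ℚ)).asIdeal.map (algebraMap (𝓞 ℚ) (𝓞 L)) ≤ w.asIdeal ^ 2)
    {p : ℕ} (hp : p.Prime) (hp2 : p ≠ 2) (hpc : p ∣ (W.baseChange ℚ_[q]).localTamagawaNumber ℤ_[q]) :
    ((W.baseChange L).baseChange (w.adicCompletion L)).localTamagawaNumber (w.adicCompletionIntegers L) =
      (W.baseChange ℚ_[q]).localTamagawaNumber ℤ_[q] := by
  classical
  have hqv : ((q : ℕ) : 𝓞 ℚ) ∈ (w.under (𝓞 ℚ)).asIdeal := LocalField.natCast_mem_under q w hqw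
  have hqq : ((Rat.HeightOneSpectrum.primesEquiv (w.under (𝓞 ℚ)) : Nat.Primes) : ℕ) = q :=
    LocalField.primesEquiv_eq_of_natCast_mem q _ hqv
  have hTam := WeierstrassCurve.localTamagawaNumber_padic_eq_holds W (w.under (𝓞 ℚ)) q hqq
  rw [hTam] at hpc ⊢
  -- instances at `w`
  haveI : Finite (ResidueField (w.adicCompletionIntegers L)) :=
    HeightOneSpectrum.finite_residueField_adicCompletionIntegers L w
  haveI : PerfectField (ResidueField (w.adicCompletionIntegers L)) := PerfectField.ofFinite
  haveI : PerfectField (ResidueField ((w.under (𝓞 ℚ)).adicCompletionIntegers ℚ)) := PerfectField.ofFinite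
  haveI : ((W.baseChange L).baseChange (w.adicCompletion L)).IsElliptic := by
    unfold WeierstrassCurve.baseChange; infer_instance
  haveI hWL : (W.baseChange L).IsElliptic := by unfold WeierstrassCurve.baseChange; infer_instance
  -- `c_q ∣ c_w`, `c_w ≠ 0`
  have hdvd := localTamagawaNumber_dvd_of_unramified W w he
  have hne : ((W.baseChange L).baseChange (w.adicCompletion L)).localTamagawaNumber (w.adicCompletionIntegers L) ≠ 0 :=
    WeierstrassCurve.localTamagawaNumber_ne_zero_holds (w.adicCompletionIntegers L) _
  -- Tate's algorithm is insensitive to the unramified base change `ℚ_q → L_w`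
  obtain ⟨hkod, hord⟩ := kodairaSymbolAt_baseChange_of_ramificationIdx_eq_one_holds L (w.under (𝓞 ℚ)) w W
    (algebraMap_comp_eq (L := L)) rfl he
  set cw := ((W.baseChange L).baseChange (w.adicCompletion L)).localTamagawaNumber (w.adicCompletionIntegers L) with hcw
  set cq := (W.baseChange ((w.under (𝓞 ℚ)).adicCompletion ℚ)).localTamagawaNumber ((w.under (𝓞 ℚ)).adicCompletionIntegers ℚ) with hcq
  obtain ⟨k, hk⟩ := hdvd
  have hk1 : 1 ≤ k := Nat.one_le_iff_ne_zero.mpr fun h0 ↦ hne (by rw [hk, h0, mul_zero])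
  rcases split_or_typeIV_of_odd_prime_dvd_localTamagawaNumber W (w.under (𝓞 ℚ)) hp hp2 hpc with
    ⟨hs, -⟩ | ⟨-, hIV, hc3⟩
  · -- split multiplicative at `q`: `c_q = ord_q Δ_min`, `c_w ≤ max 4 (ord_w Δ_min) = max 4 c_q`, and `3 ≤ p ≤ c_q`
    have hcq' : cq = W.ordMinimalDiscriminant (w.under (𝓞 ℚ)) :=
      localTamagawaNumber_eq_ordMinimalDiscriminant_of_hasSplitMultiplicativeReductionAt _ W hs
    have hle : cw ≤ max 4 cq := by
      rw [hcq', ← hord]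
      exact localTamagawaNumber_le_max_four_ordMinimalDiscriminant w (W.baseChange L)
    have hpcq : p ≤ cq := Nat.le_of_dvd (Nat.pos_of_ne_zero fun h0 ↦ hne (by rw [hk, h0, zero_mul])) hpc
    have h3p : 3 ≤ p := by have := hp.two_le; omega
    have h3cq : 3 ≤ cq := le_trans h3p hpcq
    rcases Nat.lt_or_ge k 2 with hk2 | hk2
    · have : k = 1 := by omega
      rw [hk, this, mul_one]
    · exfalso
      have : cq * 2 ≤ cq * k := Nat.mul_le_mul_left cq hk2
      rcases le_max_iff.mp hle with h4 | h4 <;> omega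
  · -- `p = 3`, Kodaira type IV ∕ IV* at `q`, `c_q = 3`: additive at `w`, so `c_w ≤ 4`, and `3 ∣ c_w` (tam3-p1 g18 verbatim)
    have hadd : W.HasAdditiveReductionAt (w.under (𝓞 ℚ)) := by
      refine (WeierstrassCurve.isAdditive_kodairaSymbolAt_iff_holds (w.under (𝓞 ℚ)) W).mp ?_
      rcases hIV with h | h <;> rw [h] <;> decide
    have haddw : (W.baseChange L).HasAdditiveReductionAt w :=
      hasAdditiveReductionAt_baseChange_of_ramificationIdx_eq_one
        (kodairaSymbolAt_baseChange_of_ramificationIdx_eq_one_holds L (w.under (𝓞 ℚ)) w W)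
        (algebraMap_comp_eq (L := L)) rfl he hadd
    have hns : ¬ (((W.baseChange L).baseChange (w.adicCompletion L)).minimal (w.adicCompletionIntegers L)).HasSplitMultiplicativeReduction
        (w.adicCompletionIntegers L) := fun hsp ↦
      WeierstrassCurve.HasMultiplicativeReductionAt.not_hasAdditiveReductionAt (W := W.baseChange L) (v := w)
        hsp.toHasMultiplicativeReduction haddw
    have hle : cw ≤ 4 := localTamagawaNumber_le_four_of_not_hasSplitMultiplicativeReduction (w.adicCompletionIntegers L) _ hns
    have hcq3 : cq = 3 := hc3
    rw [hcq3] at hk ⊢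
    omega

/-- **(C_w) `c_q • Q ∈ E₀(L_w)` for every `Q ∈ E(L_w)`** (`w ∣ q` unramified over `ℚ`, `p ∣ c_q`, `p` odd): the index of `E₀(L_w)` is `c_w = c_q`. [cite: SilvermanAEC2009, Thm. VII.6.1] -/
theorem localTamagawaNumber_nsmul_mem_goodReductionSubgroup_of_odd_prime_dvd (q : ℕ) [Fact q.Prime]
    (hqw : ((q : ℕ) : 𝓞 L) ∈ w.asIdeal) (he : ¬ (w.under (𝓞 ℚ)).asIdeal.map (algebraMap (𝓞 ℚ) (𝓞 L)) ≤ w.asIdeal ^ 2)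
    {p : ℕ} (hp : p.Prime) (hp2 : p ≠ 2) (hpc : p ∣ (W.baseChange ℚ_[q]).localTamagawaNumber ℤ_[q])
    (Q : ((W.baseChange L).baseChange (w.adicCompletion L)).toAffine.Point) :
    haveI := isMinimal_baseChange_adicCompletion_of_unramified W w he
    (W.baseChange ℚ_[q]).localTamagawaNumber ℤ_[q] • Q ∈
      ((W.baseChange L).baseChange (w.adicCompletion L)).goodReductionSubgroup (w.adicCompletionIntegers L) := by
  haveI := isMinimal_baseChange_adicCompletion_of_unramified W w he
  haveI : ((W.baseChange L).baseChange (w.adicCompletion L)).IsElliptic := by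
    unfold WeierstrassCurve.baseChange; infer_instance
  rw [← localTamagawaNumber_completion_eq_padic_of_unramified_of_odd_prime_dvd W w q hqw he hp hp2 hpc,
    WeierstrassCurve.localTamagawaNumber_eq_index_goodReductionSubgroup]
  exact AddSubgroup.nsmul_index_mem _ Q

/-- **(T_w) `E(L_w) = ι E(ℚ_q) + E₀(L_w)`** (`w ∣ q` unramified over `ℚ`, `p ∣ c_q` for an odd prime `p`): the injection `E(ℚ_q)∕E₀ ↪ E(L_w)∕E₀`
of finite groups of the same order `c_q = c_w` is onto. Port of tam3-p1 g18's `exists_sub_mapPoint_mem_goodReductionSubgroup`.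
[cite: SilvermanAEC2009, Thm. VII.6.1] [cite: SilvermanATAEC1994, IV Cor. 9.2 (d)] -/
theorem exists_sub_mapPoint_mem_goodReductionSubgroup_of_odd_prime_dvd (q : ℕ) [Fact q.Prime]
    (hqw : ((q : ℕ) : 𝓞 L) ∈ w.asIdeal) (he : ¬ (w.under (𝓞 ℚ)).asIdeal.map (algebraMap (𝓞 ℚ) (𝓞 L)) ≤ w.asIdeal ^ 2)
    {p : ℕ} (hp : p.Prime) (hp2 : p ≠ 2) (hpc : p ∣ (W.baseChange ℚ_[q]).localTamagawaNumber ℤ_[q])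
    (Q : ((W.baseChange L).baseChange (w.adicCompletion L)).toAffine.Point) :
    haveI : w.asIdeal.LiesOver (w.under (𝓞 ℚ)).asIdeal := ⟨rfl⟩
    haveI := isMinimal_baseChange_adicCompletion_of_unramified W w he
    ∃ Q₀ : (W.baseChange ((w.under (𝓞 ℚ)).adicCompletion ℚ)).toAffine.Point,
      Q - mapPoint (adicCompletionOfLiesOver ℚ L (w.under (𝓞 ℚ)) w)
          (baseChange_baseChange_eq_map_adicCompletionOfLiesOver W w).symm Q₀ ∈
        ((W.baseChange L).baseChange (w.adicCompletion L)).goodReductionSubgroup (w.adicCompletionIntegers L) := by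
  classical
  haveI : w.asIdeal.LiesOver (w.under (𝓞 ℚ)).asIdeal := ⟨rfl⟩
  haveI hminY := isMinimal_baseChange_adicCompletion_of_unramified W w he
  haveI hminX : (W.baseChange ((w.under (𝓞 ℚ)).adicCompletion ℚ)).IsMinimal ((w.under (𝓞 ℚ)).adicCompletionIntegers ℚ) :=
    IsGloballyMinimal.isMinimal (w.under (𝓞 ℚ))
  haveI : (W.baseChange ((w.under (𝓞 ℚ)).adicCompletion ℚ)).IsElliptic := by
    unfold WeierstrassCurve.baseChange; infer_instance
  haveI : ((W.baseChange L).baseChange (w.adicCompletion L)).IsElliptic := by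
    unfold WeierstrassCurve.baseChange; infer_instance
  set f := mapPoint (adicCompletionOfLiesOver ℚ L (w.under (𝓞 ℚ)) w)
    (baseChange_baseChange_eq_map_adicCompletionOfLiesOver W w).symm with hfdef
  set H₁ := (W.baseChange ((w.under (𝓞 ℚ)).adicCompletion ℚ)).goodReductionSubgroup ((w.under (𝓞 ℚ)).adicCompletionIntegers ℚ) with hH₁
  set H₂ := ((W.baseChange L).baseChange (w.adicCompletion L)).goodReductionSubgroup (w.adicCompletionIntegers L) with hH₂
  have hle : H₁ ≤ H₂.comap f := fun P hP ↦ by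
    rw [AddSubgroup.mem_comap, WeierstrassCurve.mem_goodReductionSubgroup_iff_holds]
    rw [WeierstrassCurve.mem_goodReductionSubgroup_iff_holds] at hP
    exact (isNonsingularReductionPoint_mapPoint_iff_of_unramified W w he P).mpr hP
  set φ := QuotientAddGroup.map H₁ H₂ f hle with hφ
  have hinj : Function.Injective φ := fun a b hab ↦ by
    obtain ⟨P, rfl⟩ := QuotientAddGroup.mk_surjective a
    obtain ⟨P', rfl⟩ := QuotientAddGroup.mk_surjective b
    rw [hφ, QuotientAddGroup.map_mk, QuotientAddGroup.map_mk, QuotientAddGroup.eq] at hab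
    rw [QuotientAddGroup.eq]
    rw [← map_neg, ← map_add, WeierstrassCurve.mem_goodReductionSubgroup_iff_holds,
      isNonsingularReductionPoint_mapPoint_iff_of_unramified W w he] at hab
    exact (WeierstrassCurve.mem_goodReductionSubgroup_iff_holds _ _ _).mpr hab
  -- both quotients are finite of the same cardinality `c_q = c_w`
  have hqv : ((q : ℕ) : 𝓞 ℚ) ∈ (w.under (𝓞 ℚ)).asIdeal := LocalField.natCast_mem_under q w hqw
  have hqq : ((Rat.HeightOneSpectrum.primesEquiv (w.under (𝓞 ℚ)) : Nat.Primes) : ℕ) = q :=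
    LocalField.primesEquiv_eq_of_natCast_mem q _ hqv
  have hcard : Nat.card (_ ⧸ H₁) = Nat.card (_ ⧸ H₂) := by
    rw [← AddSubgroup.index_eq_card, ← AddSubgroup.index_eq_card,
      ← WeierstrassCurve.localTamagawaNumber_eq_index_goodReductionSubgroup,
      ← WeierstrassCurve.localTamagawaNumber_eq_index_goodReductionSubgroup,
      localTamagawaNumber_completion_eq_padic_of_unramified_of_odd_prime_dvd W w q hqw he hp hp2 hpc,
      WeierstrassCurve.localTamagawaNumber_padic_eq_holds W (w.under (𝓞 ℚ)) q hqq]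
  have hne : Nat.card (_ ⧸ H₂) ≠ 0 := by
    rw [← AddSubgroup.index_eq_card, ← WeierstrassCurve.localTamagawaNumber_eq_index_goodReductionSubgroup]
    exact WeierstrassCurve.localTamagawaNumber_ne_zero_holds (w.adicCompletionIntegers L) _
  haveI : Finite (_ ⧸ H₂) := Nat.finite_of_card_ne_zero hne
  haveI : Finite (_ ⧸ H₁) := Nat.finite_of_card_ne_zero (hcard ▸ hne)
  obtain ⟨e⟩ := Finite.card_eq.mp hcard
  have hsurj : Function.Surjective φ := (Finite.injective_iff_surjective_of_equiv e).mp hinj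
  obtain ⟨a, ha⟩ := hsurj (QuotientAddGroup.mk Q)
  obtain ⟨Q₀, rfl⟩ := QuotientAddGroup.mk_surjective a
  rw [hφ, QuotientAddGroup.map_mk, QuotientAddGroup.eq] at ha
  refine ⟨Q₀, ?_⟩
  rwa [sub_eq_add_neg, add_comm]

/-! ### §1b The GLOBAL forms on `L`-points at `w` for the model `W` (port of `Theorems.CarrierLocalE0.*`, tam3-p1 g18 p644399, `3 ∣ c_q` ↦ odd `p ∣ c_q`) -/

/-- **(C) `c_q • P ∈ E₀(L)_w`** for every `P ∈ E(L)` — `w ∣ q` unramified over `ℚ`, `p ∣ c_q(W/ℚ_q)` for an odd prime `p`.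
[cite: SilvermanAEC2009, Thm. VII.6.1] [cite: SilvermanATAEC1994, IV Cor. 9.2 (d)] -/
theorem hasNonsingularReduction_localTamagawaNumber_nsmul_of_odd_prime_dvd (q : ℕ) [Fact q.Prime]
    (hqw : ((q : ℕ) : 𝓞 L) ∈ w.asIdeal) (he : ¬ (w.under (𝓞 ℚ)).asIdeal.map (algebraMap (𝓞 ℚ) (𝓞 L)) ≤ w.asIdeal ^ 2)
    {p : ℕ} (hp : p.Prime) (hp2 : p ≠ 2) (hpc : p ∣ (W.baseChange ℚ_[q]).localTamagawaNumber ℤ_[q])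
    (P : (W.baseChange L).toAffine.Point) :
    (placeIntModel W L w).HasNonsingularReduction (K := L) ((W.baseChange ℚ_[q]).localTamagawaNumber ℤ_[q] • P) := by
  rw [hasNonsingularReduction_placeIntModel_iff_mapPoint_mem W w he, map_nsmul]
  exact localTamagawaNumber_nsmul_mem_goodReductionSubgroup_of_odd_prime_dvd W w q hqw he hp hp2 hpc _

/-- **(T) every `τ ∈ Aut_ℚ(L)` fixing `w` acts trivially on `E(L) ∕ E₀(L)_w`** — `τ P − P ∈ E₀(L)_w` — for `w ∣ q` unramified over `ℚ` and
`p ∣ c_q(W/ℚ_q)`, `p` an odd prime: write the image of `P` in `E(L_w) = ι E(ℚ_q) + E₀(L_w)` as `ι Q₀ + R`; `τ_w` fixes `ι Q₀` and preserves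
`E₀(L_w)` (tam3-p1 g18's proof verbatim). [cite: SilvermanAEC2009, Thm. VII.6.1, VII §2 Prop. 2.1] [cite: CasselsFrohlichANT1967, Ch. VII §1.1] -/
theorem hasNonsingularReduction_pointGalHom_sub_of_odd_prime_dvd (q : ℕ) [Fact q.Prime]
    (hqw : ((q : ℕ) : 𝓞 L) ∈ w.asIdeal) (he : ¬ (w.under (𝓞 ℚ)).asIdeal.map (algebraMap (𝓞 ℚ) (𝓞 L)) ≤ w.asIdeal ^ 2)
    {p : ℕ} (hp : p.Prime) (hp2 : p ≠ 2) (hpc : p ∣ (W.baseChange ℚ_[q]).localTamagawaNumber ℤ_[q])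
    (τ : L ≃ₐ[ℚ] L) (hτ : τ • w = w) (P : (W.baseChange L).toAffine.Point) :
    (placeIntModel W L w).HasNonsingularReduction (K := L) (pointGalHom W L τ P - P) := by
  classical
  haveI : w.asIdeal.LiesOver (w.under (𝓞 ℚ)).asIdeal := ⟨rfl⟩
  haveI hminY := isMinimal_baseChange_adicCompletion_of_unramified W w he
  rw [hasNonsingularReduction_placeIntModel_iff_mapPoint_mem W w he, map_sub]
  -- the transport `T = (τ_w)_*` on `E(L_w)`
  set Y := (W.baseChange L).baseChange (w.adicCompletion L) with hYdef
  set τw := galAdicCompletionEquiv (L := L) τ hτ with hτw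
  have hfix : ∀ r : ℚ, (τw : w.adicCompletion L →+* w.adicCompletion L)
      (algebraMap L (w.adicCompletion L) (algebraMap ℚ L r)) = algebraMap L (w.adicCompletion L) (algebraMap ℚ L r) :=
    fun r ↦ galAdicCompletionMap_algebraMap ℚ τ hτ r
  have hT : Y.map (τw : w.adicCompletion L →+* w.adicCompletion L) = Y := by
    rw [hYdef, WeierstrassCurve.baseChange, WeierstrassCurve.baseChange, WeierstrassCurve.map_map, WeierstrassCurve.map_map]
    have hcomp : ((τw : w.adicCompletion L →+* w.adicCompletion L).comp
        ((algebraMap L (w.adicCompletion L)).comp (algebraMap ℚ L))) =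
        (algebraMap L (w.adicCompletion L)).comp (algebraMap ℚ L) :=
      RingHom.ext fun r ↦ hfix r
    exact congrArg (fun f : ℚ →+* w.adicCompletion L ↦ W.map f) hcomp
  -- `T` preserves `E₀(L_w)`
  obtain ⟨ψ, hψ⟩ : ∃ ψ : w.adicCompletionIntegers L ≃+* w.adicCompletionIntegers L,
      ∀ r, (τw : w.adicCompletion L →+* w.adicCompletion L) (algebraMap _ (w.adicCompletion L) r) = algebraMap _ _ (ψ r) := by
    refine ⟨RingEquiv.ofBijective
      (((τw : w.adicCompletion L →+* w.adicCompletion L).comp (w.adicCompletionIntegers L).subtype).codRestrict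
        (w.adicCompletionIntegers L) (fun x ↦ ?_)) ⟨fun a b hab ↦ ?_, fun b ↦ ?_⟩, fun r ↦ rfl⟩
    · exact (galAdicCompletionMap_mem_adicCompletionIntegers_iff (L := L) τ hτ (x : w.adicCompletion L)).mpr x.2
    · exact Subtype.ext (τw.injective (congrArg Subtype.val hab))
    · refine ⟨⟨τw.symm b, ?_⟩, Subtype.ext (τw.apply_symm_apply b)⟩
      rw [hτw, galAdicCompletionEquiv_symm_apply]
      exact (galAdicCompletionMap_mem_adicCompletionIntegers_iff (L := L) τ⁻¹ (inv_smul_eq_of_smul_eq hτ) (b : w.adicCompletion L)).mpr b.2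
  have hE0 : ∀ R : Y.toAffine.Point, R ∈ Y.goodReductionSubgroup (w.adicCompletionIntegers L) →
      mapPoint (τw : w.adicCompletion L →+* w.adicCompletion L) hT R ∈ Y.goodReductionSubgroup (w.adicCompletionIntegers L) := by
    intro R hR
    rw [WeierstrassCurve.mem_goodReductionSubgroup_iff_holds] at hR ⊢
    exact (Summit.BirchSwinnertonDyer.Rank1Residual.JET.isNonsingularReductionPoint_mapPoint_iff ψ τw hψ Y hT R).mpr hR
  -- `T ∘ ι = ι` on points and `T ∘ j = j ∘ τ`
  have hTι : ∀ Q₀ : (W.baseChange ((w.under (𝓞 ℚ)).adicCompletion ℚ)).toAffine.Point,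
      mapPoint (τw : w.adicCompletion L →+* w.adicCompletion L) hT
        (mapPoint (adicCompletionOfLiesOver ℚ L (w.under (𝓞 ℚ)) w) (baseChange_baseChange_eq_map_adicCompletionOfLiesOver W w).symm Q₀) =
      mapPoint (adicCompletionOfLiesOver ℚ L (w.under (𝓞 ℚ)) w) (baseChange_baseChange_eq_map_adicCompletionOfLiesOver W w).symm Q₀ := by
    rintro (_ | ⟨x, y, hxy⟩)
    · rfl
    · simp only [mapPoint_some]
      exact Affine.Point.some.injEq _ _ _ _ _ _ |>.mpr
        ⟨galAdicCompletionMap_adicCompletionOfLiesOver w τ hτ _, galAdicCompletionMap_adicCompletionOfLiesOver w τ hτ _⟩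
  have hTj : mapPoint (τw : w.adicCompletion L →+* w.adicCompletion L) hT (mapPoint (algebraMap L (w.adicCompletion L)) rfl P) =
      mapPoint (algebraMap L (w.adicCompletion L)) rfl (pointGalHom W L τ P) := by
    rcases P with _ | ⟨x, y, hxy⟩
    · rfl
    · rw [pointGalHom_apply, Affine.Point.map_some]
      simp only [mapPoint_some]
      exact Affine.Point.some.injEq _ _ _ _ _ _ |>.mpr
        ⟨galAdicCompletionMap_coe_algEquiv ℚ τ hτ _, galAdicCompletionMap_coe_algEquiv ℚ τ hτ _⟩
  -- (T_w) decomposition of the image of `P`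
  obtain ⟨Q₀, hQ₀⟩ := exists_sub_mapPoint_mem_goodReductionSubgroup_of_odd_prime_dvd W w q hqw he hp hp2 hpc
    (mapPoint (algebraMap L (w.adicCompletion L)) rfl P)
  have h1 := hE0 _ hQ₀
  rw [map_sub, hTι, hTj] at h1
  have h2 := (Y.goodReductionSubgroup (w.adicCompletionIntegers L)).sub_mem h1 hQ₀
  rwa [sub_sub_sub_cancel_right] at h2

/-- (T) for an ARBITRARY `DecidableEq L` instance on the coordinates (`DecidableEq L` is a subsingleton). [cite: SilvermanAEC2009, Thm. VII.6.1] -/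
theorem hasNonsingularReduction_pointGalHom_sub_of_odd_prime_dvd' (W : WeierstrassCurve ℚ) [W.IsElliptic] [W.IsGloballyMinimal]
    {L : Type} [Field L] [NumberField L] [DecidableEq L] (w : HeightOneSpectrum (𝓞 L)) (q : ℕ) [Fact q.Prime]
    (hqw : ((q : ℕ) : 𝓞 L) ∈ w.asIdeal) (he : ¬ (w.under (𝓞 ℚ)).asIdeal.map (algebraMap (𝓞 ℚ) (𝓞 L)) ≤ w.asIdeal ^ 2)
    {p : ℕ} (hp : p.Prime) (hp2 : p ≠ 2) (hpc : p ∣ (W.baseChange ℚ_[q]).localTamagawaNumber ℤ_[q])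
    (τ : L ≃ₐ[ℚ] L) (hτ : τ • w = w) (P : (W.baseChange L).toAffine.Point) :
    (placeIntModel W L w).HasNonsingularReduction (K := L) (pointGalHom W L τ P - P) := by
  obtain rfl : ‹DecidableEq L› = fun a b ↦ Classical.propDecidable (a = b) := Subsingleton.elim _ _
  exact hasNonsingularReduction_pointGalHom_sub_of_odd_prime_dvd W w q hqw he hp hp2 hpc τ hτ P

/-- (C) for an ARBITRARY `DecidableEq L` instance on the coordinates. [cite: SilvermanAEC2009, Thm. VII.6.1] -/
theorem hasNonsingularReduction_localTamagawaNumber_nsmul_of_odd_prime_dvd' (W : WeierstrassCurve ℚ) [W.IsElliptic] [W.IsGloballyMinimal]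
    {L : Type} [Field L] [NumberField L] [DecidableEq L] (w : HeightOneSpectrum (𝓞 L)) (q : ℕ) [Fact q.Prime]
    (hqw : ((q : ℕ) : 𝓞 L) ∈ w.asIdeal) (he : ¬ (w.under (𝓞 ℚ)).asIdeal.map (algebraMap (𝓞 ℚ) (𝓞 L)) ≤ w.asIdeal ^ 2)
    {p : ℕ} (hp : p.Prime) (hp2 : p ≠ 2) (hpc : p ∣ (W.baseChange ℚ_[q]).localTamagawaNumber ℤ_[q])
    (P : (W.baseChange L).toAffine.Point) :
    (placeIntModel W L w).HasNonsingularReduction (K := L) ((W.baseChange ℚ_[q]).localTamagawaNumber ℤ_[q] • P) := by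
  obtain rfl : ‹DecidableEq L› = fun a b ↦ Classical.propDecidable (a = b) := Subsingleton.elim _ _
  exact hasNonsingularReduction_localTamagawaNumber_nsmul_of_odd_prime_dvd W w q hqw he hp hp2 hpc P

/-! ### §1c On the ring class tower `K[n]` at a K-SPLIT carrier `q ∤ n` (unramified: tree theorem `CarrierLocalE0.not_map_le_sq_ringClassField`, p645044) -/

/-- **(T) and (C) at a K-split carrier on the whole ring class tower, for an odd prime `p ∣ c_q`** — VERBATIM the per-carrier bodies of the binders
`hT`, `hC` of `ShimuraWalk.carrierLabelsE0Prime_of_galTrivial_of_kills_of_auxLevel` (p641143). The `p ≥ 5` twin of tam3-p1 g18's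
`stub_carrierLocalE0AtThree`. [cite: SilvermanATAEC1994, IV Cor. 9.2 (d), IV.9.4 Table 4.1] [cite: SilvermanAEC2009, Thm. VII.6.1] [cite: Cox2013, §9.A] -/
theorem carrierLocalE0_ringClassField_of_odd_prime_dvd (W : WeierstrassCurve ℚ) [W.IsElliptic] [W.IsGloballyMinimal]
    (K : Type) [Field K] [NumberField K] (ι : K →+* ℂ) [∀ j : ℕ, NumberField (ringClassField K ι j)]
    (hK : IsImaginaryQuadratic K) (q : ℕ) [Fact q.Prime] {p : ℕ} (hp : p.Prime) (hp2 : p ≠ 2)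
    (hpc : p ∣ (W.baseChange ℚ_[q]).localTamagawaNumber ℤ_[q])
    (hq2 : ((Ideal.span {(q : ℤ)}).primesOver (𝓞 K)).ncard = 2) :
    (∀ n : ℕ, n ≠ 0 → ¬ q ∣ n → ∀ (w : HeightOneSpectrum (𝓞 (ringClassField K ι n))),
      ((q : ℕ) : 𝓞 (ringClassField K ι n)) ∈ w.asIdeal →
      ∀ τ : ringClassField K ι n ≃ₐ[ℚ] ringClassField K ι n, τ • w.asIdeal = w.asIdeal →
      ∀ P : (W.baseChange (ringClassField K ι n)).toAffine.Point,
        (placeIntModel W (ringClassField K ι n) w).HasNonsingularReduction (K := ringClassField K ι n)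
          (pointGalHom W (ringClassField K ι n) τ P - P)) ∧
    (∀ n : ℕ, n ≠ 0 → ¬ q ∣ n → ∀ (w : HeightOneSpectrum (𝓞 (ringClassField K ι n))),
      ((q : ℕ) : 𝓞 (ringClassField K ι n)) ∈ w.asIdeal →
      ∀ P : (W.baseChange (ringClassField K ι n)).toAffine.Point,
        (placeIntModel W (ringClassField K ι n) w).HasNonsingularReduction (K := ringClassField K ι n)
          ((W.baseChange ℚ_[q]).localTamagawaNumber ℤ_[q] • P)) := by
  refine ⟨fun n hn hqn w hqw τ hτ P ↦ ?_, fun n hn hqn w hqw P ↦ ?_⟩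
  · have he := not_map_le_sq_ringClassField K ι hK q hq2 n hn hqn w hqw
    have hτ' : τ • w = w := HeightOneSpectrum.ext hτ
    exact hasNonsingularReduction_pointGalHom_sub_of_odd_prime_dvd' W w q hqw he hp hp2 hpc τ hτ' P
  · exact hasNonsingularReduction_localTamagawaNumber_nsmul_of_odd_prime_dvd' W w q hqw
      (not_map_le_sq_ringClassField K ι hK q hq2 n hn hqn w hqw) hp hp2 hpc P

end Summit.BirchSwinnertonDyer.BirchSwinnertonDyer.Theorems.CarrierLocalE0OddPrime

/-! ## §2 ROAD B assembled: the binder `hE0T` on a `p ≥ 5` Shimura frame with NO leaf stub -/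

namespace Summit.BirchSwinnertonDyer.BirchSwinnertonDyer.Theorems.AuxNormReceptacle

open WeierstrassCurve IsDedekindDomain NumberField Field Literature.NumberTheory.EllipticCurves
  Literature.NumberTheory.GaloisRepresentations Summit.BirchSwinnertonDyer.Rank1Residual.X11b
  Summit.BirchSwinnertonDyer.BirchSwinnertonDyer.Theorems Rat.HeightOneSpectrum
  Literature.NumberTheory.NumberFields Literature.NumberTheory.NumberFields.RingClassField
  Literature.NumberTheory.QuadraticFields.RingClass

/-- **ROAD B — the binder `hE0T` of 19715's carrier-label receptacle on a `p ≥ 5` frame, from TREE THEOREMS ONLY (zero leaf stubs).**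
`K` imaginary quadratic with `d_K < −4`, `p ≥ 5` with surjective mod-`p` image, `N ≠ 0`, every prime `q ∣ N` outside `S` split in `K` (`hsp`),
a family `ys` with `ShimuraWalk.LabelsAt W N K ι y ys ε` ((B4) = Gross's norm relation): at every carrier `q ∣ N`, `q ∉ S`, `p ∣ c_q` there is
ONE `n'` prime to `p` with `n' • ys m ∈ E₀(K[m])_w` at every guarded level `m` and every `w ∋ q` — the SAME conclusion as
`carrierLabelsE0Prime_of_leaves` ∕ `…_of_linearLeaves` (road A), with NO S1 ∕ S1-lin ∕ (C) ∕ (O) hypothesis. Assembly (= v6 §5d):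
`ShimuraWalk.carrierLabelsE0Prime_of_galTrivial_of_kills_of_auxLevel` (bsd-stepL-tam3-p1 g18, p641143) fed with hT, hC :=
`CarrierLocalE0OddPrime.carrierLocalE0_ringClassField_of_odd_prime_dvd` (§1) and hAux := `auxiliaryInertLevel_of_laws` (p644422) on S2♭
`relativeStabilizerLaw` (p642411) and S3♭ `AuxPrimeSupply.auxiliaryPrimeSupply` (p645521). HONEST FRAMING: discharges the binder `hE0T` of the LEAD's
v15 closer on frames with `d_K < −4`; it does NOT close 19715 (the seven route items of `_of` are untouched); BSD is proved for no curve.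
[cite: GrossLMS1991, §3 Prop. 3.7 (1), §6 proof of Prop. 6.2 (1) (p. 245 «E′»)] [cite: SilvermanATAEC1994, IV Cor. 9.2 (d), IV.9.4 Table 4.1]
[cite: SilvermanAEC2009, Thm. VII.6.1] [cite: Cox2013, Thm. 7.24, Thm. 8.12, §9.A] [cite: Serre1972, §4.4 Lemme 3] -/
theorem carrierLabelsE0Prime_of_galTrivialRoad (W : WeierstrassCurve ℚ) [W.IsElliptic] [W.IsGloballyMinimal]
    {K : Type} [Field K] [NumberField K] (ι : K →+* ℂ) [∀ j : ℕ, NumberField (ringClassField K ι j)]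
    (hK : IsImaginaryQuadratic K) (hdK : NumberField.discr K < -4) {p : ℕ} [Fact p.Prime] (hp5 : 5 ≤ p)
    (hsurj : W.HasSurjectiveModNGaloisRep p) {N : ℕ} (hN : N ≠ 0) {S : Finset ℕ}
    (hsp : ∀ ℓ : ℕ, ℓ.Prime → ℓ ∣ N → ℓ ∉ S → ((Ideal.span {(ℓ : ℤ)}).primesOver (𝓞 K)).ncard = 2)
    (ys : (m : ℕ) → (W.baseChange (ringClassField K ι m)).toAffine.Point)
    {y : (W.baseChange K).toAffine.Point} {ε : ℤ} (hLab : ShimuraWalk.LabelsAt W N K ι y ys ε) :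
    ∀ (q : ℕ) [Fact q.Prime], q ∣ N → q ∉ S → p ∣ (W.baseChange ℚ_[q]).localTamagawaNumber ℤ_[q] →
      ∃ n' : ℕ, ¬ p ∣ n' ∧ ∀ m : ℕ, Squarefree m → (∀ r ∈ m.primeFactors, ¬ r ∣ N ∧ (Ideal.span {(r : 𝓞 K)}).IsPrime) →
        ∀ [NumberField (ringClassField K ι m)] (w : HeightOneSpectrum (𝓞 (ringClassField K ι m))),
          ((q : ℕ) : 𝓞 (ringClassField K ι m)) ∈ w.asIdeal →
          (placeIntModel W (ringClassField K ι m) w).HasNonsingularReduction (K := ringClassField K ι m) (n' • ys m) := by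
  have hp : p.Prime := Fact.out
  have hp2 : p ≠ 2 := by omega
  refine ShimuraWalk.carrierLabelsE0Prime_of_galTrivial_of_kills_of_auxLevel W ι hK
    (fun q _ hqN hqS hpc ↦
      (CarrierLocalE0OddPrime.carrierLocalE0_ringClassField_of_odd_prime_dvd
        W K ι hK q hp hp2 hpc (hsp q Fact.out hqN hqS)).1)
    (fun q _ hqN hqS hpc ↦
      (CarrierLocalE0OddPrime.carrierLocalE0_ringClassField_of_odd_prime_dvd
        W K ι hK q hp hp2 hpc (hsp q Fact.out hqN hqS)).2)
    (fun q _ hqN hqS _ ↦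
      -- AUX: the tree glue `auxiliaryInertLevel_of_laws` (p644422) on S2♭ (p642411) and S3♭ (p645521); its value
      -- `AuxiliaryInertLevel W K ι p q N` unfolds to p641143's `hAux` body.
      auxiliaryInertLevel_of_laws W K ι hK hqN (relativeStabilizerLaw hK ι q)
        (AuxPrimeSupply.auxiliaryPrimeSupply W K hK hdK p hp5 hsurj q (hsp q Fact.out hqN hqS) N hN))
    ys hLab

/-- **Road B with ONE exponent for all carriers** (plug into `ShimuraKolyvaginOfImage.exists_uniform_exponent_of_carrierLabelsE0Prime`). [cite: GrossLMS1991, §6 proof of Prop. 6.2 (1), p. 245] -/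
theorem exists_uniform_exponent_of_galTrivialRoad (W : WeierstrassCurve ℚ) [W.IsElliptic] [W.IsGloballyMinimal]
    {K : Type} [Field K] [NumberField K] (ι : K →+* ℂ) [∀ j : ℕ, NumberField (ringClassField K ι j)]
    (hK : IsImaginaryQuadratic K) (hdK : NumberField.discr K < -4) {p : ℕ} [Fact p.Prime] (hp5 : 5 ≤ p)
    (hsurj : W.HasSurjectiveModNGaloisRep p) {N : ℕ} [NeZero N] {S : Finset ℕ}
    (hsp : ∀ ℓ : ℕ, ℓ.Prime → ℓ ∣ N → ℓ ∉ S → ((Ideal.span {(ℓ : ℤ)}).primesOver (𝓞 K)).ncard = 2)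
    (ys : (m : ℕ) → (W.baseChange (ringClassField K ι m)).toAffine.Point)
    {y : (W.baseChange K).toAffine.Point} {ε : ℤ} (hLab : ShimuraWalk.LabelsAt W N K ι y ys ε) :
    ∃ n' : ℕ, ¬ p ∣ n' ∧ ∀ (q : ℕ) [Fact q.Prime], q ∣ N → q ∉ S → p ∣ (W.baseChange ℚ_[q]).localTamagawaNumber ℤ_[q] →
      ∀ m : ℕ, Squarefree m → (∀ r ∈ m.primeFactors, ¬ r ∣ N ∧ (Ideal.span {(r : 𝓞 K)}).IsPrime) →
        ∀ [NumberField (ringClassField K ι m)] (w : HeightOneSpectrum (𝓞 (ringClassField K ι m))),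
          ((q : ℕ) : 𝓞 (ringClassField K ι m)) ∈ w.asIdeal →
          (placeIntModel W (ringClassField K ι m) w).HasNonsingularReduction (K := ringClassField K ι m) (n' • ys m) :=
  ShimuraKolyvaginOfImage.exists_uniform_exponent_of_carrierLabelsE0Prime W ι p S ys
    (fun q _ hqN hqS htam ↦ carrierLabelsE0Prime_of_galTrivialRoad W ι hK hdK hp5 hsurj (NeZero.ne N) hsp ys hLab q hqN hqS htam)

end Summit.BirchSwinnertonDyer.BirchSwinnertonDyer.Theorems.AuxNormReceptacle

end
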